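import Literature.NumberTheory.Automorphic.UnitaryGroupAutomorphicRep   -- ★ `unitaryGroupOfForm`, `mem_unitaryGroupOfForm_iff`
import Mathlib.FieldTheory.Finite.Basic                                 -- `FiniteField.exists_nonsquare`
import Mathlib.LinearAlgebra.Matrix.Rank
import HarnessLib

/-!
# Jordan rank does NOT classify the unipotent classes of `Sp₂(K) = SL₂(K)`: `u(1)` and `u(ε)` are conjugate iff `ε` is a square
# (the finite layer of the S3-tree at the SECOND tame-ramified vertex — residue group SYMPLECTIC — a NEGATIVE lemma)

Topic `Literature/GroupTheory/SpecificGroups`; namespace `Literature.GroupTheory.SpecificGroups`.  THEOREMS ONLY (no definition, no named fact, no instance, no notation,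
no `sorry`).  Cell `pub/hodgecm-mathlib` (crux H413 = `stmt-HodgeConjecture-24833`), «S3-ram» seeding wave (LEAD T11-41; owner p06 (g15); seat F0P3-p03 (g14)), companion
of ★ p846826 `OrthogonalThreeUnipotentJordanClasses`.  At a tame-ramified non-split place the Bruhat–Tits tree of `U(3)` has TWO vertex types, both special (★ B-p14
`UnitaryLatticeTreeValencyRamified`): the self-dual vertex with residue group ORTHOGONAL `O₃(𝔽_q)` — where Jordan rank DOES classify unipotent classes (★ p846826) — and
the `ϖ`-modular vertex whose reductive quotient is SYMPLECTIC `Sp₂(𝔽_q) × O₁(𝔽_q)`.  THIS FILE records, for the tree's `unitaryGroupOfForm (RingHom.id K) J` with the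
alternating `J = !![0, 1; -1, 0]` (so `U(id, J) = Sp₂(K) = SL₂(K)`), that the (U)-organ's hypothesis «a conjugation-invariant function is constant on each Jordan stratum»
FAILS there: every non-trivial unipotent `u(t) = !![1, t; 0, 1]` has `rank(u − 1) = 1`, but **`u(t)` and `u(t′)` are `Sp₂(K)`-conjugate only if `t′ = a²t`**, hence
`u(1) ≁ u(ε)` for a non-square `ε` (which exists in `𝔽_q`, `q` odd — Mathlib `FiniteField.exists_nonsquare`).  This is the residual shadow of p08 (g18)'s finding
(T11-43 (3)): at a ramified place the similitude `diag(ε,1,1)` swaps two `K`-classes of transvections, so `Ad K`-invariant pieces do not separate them — one level down,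
`Ad Sp₂(𝔽_q)`-invariance does not force equal values on the two rank-`1` classes; strata constancy «by rank» at that vertex needs `GSp₂`-invariance.
HONEST LABEL: HC_CM is proved only modulo the printed citations (the 2 remaining named inputs hLiu418, h413) until rung 0 closes; elementary `2 × 2` algebra, asserts
nothing about the `p`-adic groups.

* `mem_unitaryGroupOfForm_id_altTwo_iff_det_eq_one` — `U(id, J_alt) = SL₂`: `g ∈ U(id, !![0,1;-1,0]) ↔ det g = 1`;
* `lineUnipotent_mem`, `rank_lineUnipotent_sub_one` — `u(t) ∈ Sp₂`, `rank(u(t) − 1) = 1` for `t ≠ 0`;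
* **`exists_sq_mul_eq_of_conj_lineUnipotent`** — `g u(t) g⁻¹ = u(t′)` with `det g = 1`, `t′ ≠ 0` ⇒ `∃ a, t′ = a² t`;
* **`not_exists_conj_lineUnipotent_of_not_isSquare`** — `ε` not a square ⇒ `u(1)` and `u(ε)` are NOT `U(id, J_alt)`-conjugate;
* **`exists_rank_eq_not_conj_of_ringChar_ne_two`** — over a finite field of odd characteristic there are two unipotents of `U(id, J_alt)` of Jordan rank `1` that are not conjugate.

## References
* [Wilson2009] R. A. Wilson, *The Finite Simple Groups*, GTM 251 (2009): §3.3.1 p. 46 (unipotent classes of `SL₂(q)`: two classes of transvections for `q` odd), §3.5 (symplectic groups).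
* [Rogawski1990] J. D. Rogawski, *Automorphic Representations of Unitary Groups in Three Variables*, Ann. of Math. Stud. 123 (1990): §3.9 p. 32 (classes of `n(t)` by `t mod NE^×`).
-/

set_option autoImplicit false

open Matrix Literature.NumberTheory.Automorphic

namespace Literature.GroupTheory.SpecificGroups

variable {K : Type*} [Field K]

/-- **`U(id, J_alt) = SL₂`**: for the alternating form `J = !![0, 1; -1, 0]`, `gᵀ J g = det(g)·J`, so `g ∈ U(id, J) ↔ det g = 1`. [cite: Wilson2009, §3.5 p. 55] -/
theorem mem_unitaryGroupOfForm_id_altTwo_iff_det_eq_one (g : GL (Fin 2) K) :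
    g ∈ unitaryGroupOfForm (RingHom.id K) !![(0 : K), 1; -1, 0] ↔ (g : Matrix (Fin 2) (Fin 2) K).det = 1 := by
  rw [mem_unitaryGroupOfForm_iff]
  have hform : (((g : Matrix (Fin 2) (Fin 2) K).map (RingHom.id K))ᵀ * !![(0 : K), 1; -1, 0] * (g : Matrix (Fin 2) (Fin 2) K)) =
      (g : Matrix (Fin 2) (Fin 2) K).det • !![(0 : K), 1; -1, 0] := by
    ext i j
    rw [Matrix.det_fin_two]
    fin_cases i <;> fin_cases j <;> simp [Matrix.mul_apply, Fin.sum_univ_two, Matrix.transpose_apply] <;> ring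
  rw [hform]
  constructor
  · intro h
    have h01 := congrFun (congrFun h 0) 1
    simpa using h01
  · intro h
    rw [h, one_smul]

/-- `u(t) = !![1, t; 0, 1] ∈ U(id, J_alt)` (as the unit with inverse `u(−t)`). [cite: Wilson2009, §3.3.1 p. 46] -/
theorem lineUnipotent_mem (t : K) :
    (⟨!![1, t; 0, 1], !![1, -t; 0, 1], by ext i j; fin_cases i <;> fin_cases j <;> simp [Matrix.mul_apply, Fin.sum_univ_two],
      by ext i j; fin_cases i <;> fin_cases j <;> simp [Matrix.mul_apply, Fin.sum_univ_two]⟩ : GL (Fin 2) K) ∈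
      unitaryGroupOfForm (RingHom.id K) !![(0 : K), 1; -1, 0] := by
  rw [mem_unitaryGroupOfForm_id_altTwo_iff_det_eq_one]
  simp [Matrix.det_fin_two]

/-- **`rank(u(t) − 1) = 1` for `t ≠ 0`**: every non-trivial `u(t)` has Jordan rank `1`. [cite: Wilson2009, §3.3.1 p. 46] -/
theorem rank_lineUnipotent_sub_one {t : K} (ht : t ≠ 0) : (!![1, t; 0, 1] - (1 : Matrix (Fin 2) (Fin 2) K)).rank = 1 := by
  have h : !![1, t; 0, 1] - (1 : Matrix (Fin 2) (Fin 2) K) = Matrix.vecMulVec (Pi.single 0 (1 : K)) (Pi.single 1 t) := by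
    ext i j; fin_cases i <;> fin_cases j <;> simp [Matrix.vecMulVec_apply]
  have hle : (!![1, t; 0, 1] - (1 : Matrix (Fin 2) (Fin 2) K)).rank ≤ 1 := by rw [h]; exact Matrix.rank_vecMulVec_le _ _
  have hne : (!![1, t; 0, 1] - (1 : Matrix (Fin 2) (Fin 2) K)).rank ≠ 0 := by
    intro h0
    rw [Matrix.rank, Submodule.finrank_eq_zero, LinearMap.range_eq_bot] at h0
    have h1 := congrArg (fun f : (Fin 2 → K) →ₗ[K] (Fin 2 → K) => f (Pi.single 1 1) 0) h0
    simp at h1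
    exact ht h1
  omega

/-- **Conjugate line unipotents differ by a SQUARE**: if `det g = 1` and `g·u(t) = u(t′)·g` with `t′ ≠ 0`, then `t′ = a²·t` for some `a` (namely `g = !![a, b; 0, a⁻¹]`).
[cite: Wilson2009, §3.3.1 p. 46] [cite: Rogawski1990, §3.9 p. 32] -/
theorem exists_sq_mul_eq_of_conj_lineUnipotent {g : Matrix (Fin 2) (Fin 2) K} (hg : g.det = 1) {t t' : K} (ht' : t' ≠ 0)
    (h : g * !![1, t; 0, 1] = !![1, t'; 0, 1] * g) : ∃ a : K, t' = a ^ 2 * t := by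
  have h00 := congrFun (congrFun h 0) 0
  have h01 := congrFun (congrFun h 0) 1
  simp [Matrix.mul_apply, Fin.sum_univ_two] at h00 h01
  -- `h00 : g 0 0 = g 0 0 + t' * g 1 0`: read off `c = 0`, then `a t = t′ d`, `a d = 1`
  have hc : g 1 0 = 0 := h00.resolve_left ht'
  rw [Matrix.det_fin_two, hc, mul_zero, sub_zero] at hg
  refine ⟨g 0 0, ?_⟩
  -- `h01 : g 0 0 * t + g 0 1 = g 0 1 + t' * g 1 1`
  have h2 : g 0 0 * t = t' * g 1 1 := by linear_combination h01
  calc t' = t' * (g 0 0 * g 1 1) := by rw [hg, mul_one]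
    _ = g 0 0 * (t' * g 1 1) := by ring
    _ = g 0 0 * (g 0 0 * t) := by rw [h2]
    _ = g 0 0 ^ 2 * t := by ring

/-- **`u(1)` and `u(ε)` are NOT `Sp₂(K)`-conjugate when `ε` is not a square** — although both have Jordan rank `1`.
[cite: Wilson2009, §3.3.1 p. 46] [cite: Rogawski1990, §3.9 p. 32] -/
theorem not_exists_conj_lineUnipotent_of_not_isSquare {ε : K} (hε : ¬ IsSquare ε) (u u' : GL (Fin 2) K)
    (hu : (u : Matrix (Fin 2) (Fin 2) K) = !![1, 1; 0, 1]) (hu' : (u' : Matrix (Fin 2) (Fin 2) K) = !![1, ε; 0, 1]) :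
    ¬ ∃ g : GL (Fin 2) K, g ∈ unitaryGroupOfForm (RingHom.id K) !![(0 : K), 1; -1, 0] ∧ g * u * g⁻¹ = u' := by
  rintro ⟨g, hg, hconj⟩
  have hε0 : ε ≠ 0 := fun h0 => hε ⟨0, by rw [h0, mul_zero]⟩
  have hdet := (mem_unitaryGroupOfForm_id_altTwo_iff_det_eq_one g).1 hg
  have hmat : (g : Matrix (Fin 2) (Fin 2) K) * !![1, 1; 0, 1] = !![1, ε; 0, 1] * (g : Matrix (Fin 2) (Fin 2) K) := by
    have h1 : g * u = u' * g := by rw [← hconj, inv_mul_cancel_right]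
    have h := congrArg (fun x : GL (Fin 2) K => (x : Matrix (Fin 2) (Fin 2) K)) h1
    simp only [Units.val_mul, hu, hu'] at h
    exact h
  obtain ⟨a, ha⟩ := exists_sq_mul_eq_of_conj_lineUnipotent hdet hε0 hmat
  exact hε ⟨a, by rw [ha, mul_one, sq]⟩

/-- **Over a finite field of odd characteristic, Jordan rank does NOT classify the unipotent classes of `U(id, J_alt) = Sp₂ = SL₂`**: there are two unipotent elements with
`rank(u − 1) = rank(u′ − 1) = 1` that are not conjugate (`u(1)`, `u(ε)` with `ε` a non-square, Mathlib `FiniteField.exists_nonsquare`) — contrast ★ p846826 for `O₃`.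
[cite: Wilson2009, §3.3.1 p. 46] -/
theorem exists_rank_eq_not_conj_of_ringChar_ne_two [Fintype K] (hK : ringChar K ≠ 2) :
    ∃ u u' : GL (Fin 2) K, u ∈ unitaryGroupOfForm (RingHom.id K) !![(0 : K), 1; -1, 0] ∧ u' ∈ unitaryGroupOfForm (RingHom.id K) !![(0 : K), 1; -1, 0] ∧
      IsNilpotent ((u : Matrix (Fin 2) (Fin 2) K) - 1) ∧ IsNilpotent ((u' : Matrix (Fin 2) (Fin 2) K) - 1) ∧
      ((u : Matrix (Fin 2) (Fin 2) K) - 1).rank = 1 ∧ ((u' : Matrix (Fin 2) (Fin 2) K) - 1).rank = 1 ∧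
      ¬ ∃ g : GL (Fin 2) K, g ∈ unitaryGroupOfForm (RingHom.id K) !![(0 : K), 1; -1, 0] ∧ g * u * g⁻¹ = u' := by
  obtain ⟨ε, hε⟩ := FiniteField.exists_nonsquare hK
  have hε0 : ε ≠ 0 := fun h0 => hε ⟨0, by rw [h0, mul_zero]⟩
  have hnil : ∀ t : K, IsNilpotent (!![1, t; 0, 1] - (1 : Matrix (Fin 2) (Fin 2) K)) := fun t =>
    ⟨2, by ext i j; fin_cases i <;> fin_cases j <;> simp [pow_two, Matrix.mul_apply, Fin.sum_univ_two]⟩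
  refine ⟨_, _, lineUnipotent_mem (1 : K), lineUnipotent_mem ε, hnil 1, hnil ε, rank_lineUnipotent_sub_one one_ne_zero, rank_lineUnipotent_sub_one hε0,
    not_exists_conj_lineUnipotent_of_not_isSquare hε _ _ rfl rfl⟩

end Literature.GroupTheory.SpecificGroups
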